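import Mathlib
import HarnessLib
import Summits.Ventures.LatticeQCDFlow.Exactness.SU2ClosedFormExponential
import Summits.Ventures.LatticeQCDFlow.Exactness.GaugeEquivariance

/-!
# Masked `SU(2)` kick layers whose local field transforms like a link are gauge-equivariant

HONEST FRAMING: exact (Metropolis-corrected) sampling algorithms for lattice gauge theory;
figures of merit are autocorrelation/cost numbers at stated couplings and volumes; no
continuum-physics claim.

Venture `LatticeQCDFlow` (cell pub-lqcd), topic `Exactness`; FANOUT row 14 (`eng-flowhmc`, engine
`latflow.fthmc`, family B — "gauge-equivariant" field transformations: `maps.wilson_flow_lo`,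
`maps.resid_substep_flat`).  NEW WORK of the cell; nothing is cited as a fact; no number.
Exactness never needed equivariance (the NOT-CLAIMED column of `SU2ResidualLayer.lean`); this file
records it anyway, in the vocabulary of row 30's `GaugeEquivariance.IsGaugeEquivariant`, from the
matrix form of the sub-step typed in `SU2ClosedFormExponential.coe_su2Substep_eq_exp_mul`
(`U' = exp((c/2)(Q_J Uᴴ − (Q_J Uᴴ)ᴴ)) · U`, `Q_J = quatVec J`):

* `exp_conj_specialUnitary` — `exp(g X g⁻¹) = g · exp X · g⁻¹` for `g ∈ SU(2)` (Mathlib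
  `Matrix.exp_conj`);
* `su2Kick_gauge` — ONE LINK: if the local field transforms like the link,
  `quatVec J' = g_x · quatVec J · g_y⁻¹`, then the kicked link transforms like a link:
  `kick_{J'}(g_x U g_y⁻¹) = g_x · kick_J(U) · g_y⁻¹` (`y = x + μ̂`);
* **`isGaugeEquivariant_su2MaskedKick`** — THE LAYER: for any mask `p` and any local field
  `J : GaugeConfig d L SU(2) → Edge d L → ℝ⁴` with
  `quatVec (J (V^g) e) = g(e.1) · quatVec (J V e) · g(e.1 + ê.2)⁻¹` at active links (the
  conjugate staple sums of the LO member, and the WEIGHTED conjugate staple sums of the learned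
  residual layers whenever the weights are gauge INVARIANT — e.g. functions of plaquette traces),
  the masked kick layer `V ↦ (e ↦ if p e then gaussUnit (geodesicKick ε (J V e) (vecQuat (V e))) else V e)`
  is `IsGaugeEquivariant`.

NOT CLAIMED here: the verification that the (weighted) conjugate staple field transforms like a
link (path-ordered product bookkeeping, left to a sequel); invariance of network weights; any
number.
-/

noncomputable section

namespace Summit.Ventures.LatticeQCDFlow.Exactness

open Real WithLp NormedSpace
open Literature.MathematicalPhysics.QuantumFieldTheory
open scoped Matrix

/-! ## Conjugating the exponential by a special unitary matrix -/

/-- `exp(g X g⁻¹) = g exp(X) g⁻¹` for `g ∈ SU(2)` (as matrices; `g⁻¹ = gᴴ`). -/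
theorem exp_conj_specialUnitary (g : Matrix.specialUnitaryGroup (Fin 2) ℂ) (X : Matrix (Fin 2) (Fin 2) ℂ) :
    exp ((g : Matrix (Fin 2) (Fin 2) ℂ) * X * (g : Matrix (Fin 2) (Fin 2) ℂ)ᴴ) =
      (g : Matrix (Fin 2) (Fin 2) ℂ) * exp X * (g : Matrix (Fin 2) (Fin 2) ℂ)ᴴ := by
  have hgg : (g : Matrix (Fin 2) (Fin 2) ℂ) * (g : Matrix (Fin 2) (Fin 2) ℂ)ᴴ = 1 := by
    rw [← WilsonFlow.coe_inv_SU, ← WilsonFlow.coe_mul_SU, mul_inv_cancel, OneMemClass.coe_one]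
  have hinv : (g : Matrix (Fin 2) (Fin 2) ℂ)⁻¹ = (g : Matrix (Fin 2) (Fin 2) ℂ)ᴴ := Matrix.inv_eq_right_inv hgg
  have hunit : IsUnit (g : Matrix (Fin 2) (Fin 2) ℂ) := (Matrix.isUnit_iff_isUnit_det _).mpr (by
    rw [(Matrix.mem_specialUnitaryGroup_iff.mp g.2).2]
    exact isUnit_one)
  rw [← hinv]
  exact Matrix.exp_conj _ _ hunit

/-! ## One link -/

/-- **One link: a kick by a field that transforms like the link transforms like the link.**  For
`g_x, g_y ∈ SU(2)`, a link `U`, and local fields `J, J'` with `quatVec J' = g_x · quatVec J · g_yᴴ`: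
`gaussUnit (geodesicKick c J' (vecQuat (g_x U g_y⁻¹))) = g_x · gaussUnit (geodesicKick c J (vecQuat U)) · g_y⁻¹`. -/
theorem su2Kick_gauge (gx gy U : Matrix.specialUnitaryGroup (Fin 2) ℂ) (c : ℝ) {J J' : R4}
    (hJ : quatVec J' = (gx : Matrix (Fin 2) (Fin 2) ℂ) * quatVec J * (gy : Matrix (Fin 2) (Fin 2) ℂ)ᴴ) :
    gaussUnit (geodesicKick c J' (vecQuat (((gx * U * gy⁻¹ : Matrix.specialUnitaryGroup (Fin 2) ℂ)) :
        Matrix (Fin 2) (Fin 2) ℂ))) =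
      gx * gaussUnit (geodesicKick c J (vecQuat (U : Matrix (Fin 2) (Fin 2) ℂ))) * gy⁻¹ := by
  apply Subtype.ext
  rw [coe_su2Substep_eq_exp_mul (gx * U * gy⁻¹) c J']
  simp only [WilsonFlow.coe_mul_SU, WilsonFlow.coe_inv_SU]
  rw [coe_su2Substep_eq_exp_mul U c J, hJ]
  set G : Matrix (Fin 2) (Fin 2) ℂ := (gx : Matrix (Fin 2) (Fin 2) ℂ) with hG
  set H : Matrix (Fin 2) (Fin 2) ℂ := (gy : Matrix (Fin 2) (Fin 2) ℂ) with hH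
  set W : Matrix (Fin 2) (Fin 2) ℂ := (U : Matrix (Fin 2) (Fin 2) ℂ) with hW
  have hHH : Hᴴ * H = 1 := by
    rw [hH, ← WilsonFlow.coe_inv_SU, ← WilsonFlow.coe_mul_SU, inv_mul_cancel, OneMemClass.coe_one]
  have hGG : Gᴴ * G = 1 := by
    rw [hG, ← WilsonFlow.coe_inv_SU, ← WilsonFlow.coe_mul_SU, inv_mul_cancel, OneMemClass.coe_one]
  -- the exponent is conjugated by `G`
  have hX : (((c / 2 : ℝ)) : ℂ) • (G * quatVec J * Hᴴ * (G * W * Hᴴ)ᴴ - (G * quatVec J * Hᴴ * (G * W * Hᴴ)ᴴ)ᴴ) =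
      G * ((((c / 2 : ℝ)) : ℂ) • (quatVec J * Wᴴ - (quatVec J * Wᴴ)ᴴ)) * Gᴴ := by
    have e1 : G * quatVec J * Hᴴ * (G * W * Hᴴ)ᴴ = G * (quatVec J * Wᴴ) * Gᴴ := by
      rw [Matrix.conjTranspose_mul, Matrix.conjTranspose_mul, Matrix.conjTranspose_conjTranspose]
      simp only [Matrix.mul_assoc]
      rw [← Matrix.mul_assoc Hᴴ H, hHH, Matrix.one_mul]
    rw [e1, Matrix.conjTranspose_mul, Matrix.conjTranspose_mul, Matrix.conjTranspose_conjTranspose,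
      Matrix.mul_smul, Matrix.smul_mul, Matrix.mul_sub, Matrix.sub_mul]
    simp only [Matrix.mul_assoc]
  rw [hX, exp_conj_specialUnitary]
  simp only [Matrix.mul_assoc]
  rw [← Matrix.mul_assoc Gᴴ G, hGG, Matrix.one_mul]

/-! ## The masked layer -/

section Layer

variable {d L : ℕ} (p : Edge d L → Prop) [DecidablePred p]

/-- **A masked `SU(2)` kick layer driven by a field that transforms like a link is gauge
equivariant.**  If at every active link `e = (x, μ)` the local field satisfies
`quatVec (J (V^g) e) = g(x) · quatVec (J V e) · g(x + μ̂)ᴴ`, then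
`F(V^g) = F(V)^g` for the masked kick layer `F`. -/
theorem isGaugeEquivariant_su2MaskedKick {ε : ℝ}
    (J : GaugeConfig d L (Matrix.specialUnitaryGroup (Fin 2) ℂ) → Edge d L → R4)
    (hJ : ∀ (g : Site d L → Matrix.specialUnitaryGroup (Fin 2) ℂ)
      (V : GaugeConfig d L (Matrix.specialUnitaryGroup (Fin 2) ℂ)) (e : Edge d L), p e →
        quatVec (J (gaugeTransform g V) e) =
          (g e.1 : Matrix (Fin 2) (Fin 2) ℂ) * quatVec (J V e) * (g (e.1.shift e.2) : Matrix (Fin 2) (Fin 2) ℂ)ᴴ) :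
    IsGaugeEquivariant (fun (V : GaugeConfig d L (Matrix.specialUnitaryGroup (Fin 2) ℂ)) (e : Edge d L) =>
      if p e then gaussUnit (geodesicKick ε (J V e)
        (vecQuat ((V e : Matrix.specialUnitaryGroup (Fin 2) ℂ) : Matrix (Fin 2) (Fin 2) ℂ)))
      else V e) := by
  intro g V
  funext e
  have hgt : ∀ (W : GaugeConfig d L (Matrix.specialUnitaryGroup (Fin 2) ℂ)) (e' : Edge d L),
      gaugeTransform g W e' = g e'.1 * W e' * (g (e'.1.shift e'.2))⁻¹ := fun _ _ => rfl
  by_cases he : p e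
  · have h := su2Kick_gauge (g e.1) (g (e.1.shift e.2)) (V e) ε (hJ g V e he)
    simp only [if_pos he, hgt]
    exact h
  · simp only [if_neg he, hgt]

end Layer

end Summit.Ventures.LatticeQCDFlow.Exactness
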